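import Summits.NavierStokesRegularity.NavierStokesRegularity.Theorems.ScenarioCensusRowF1QuenchedTransfer
import Summits.NavierStokesRegularity.NavierStokesRegularity.Theorems.ScenarioCensusRowF1IntQuenchTop
import HarnessLib

/-!
# LINE 21 «quenched-top» port, part 3/3: §7 rows `Row_F1qnq` / `Row_F1qn`, Liouville rows `Liouville_nonIntensifying` / `Liouville_qnq`, floor `IntensifyingTop`, residual
# `QuenchSlack` (≡ `Row_F1`); the rows are EXCLUDED; displays; census KEYS `Row_F1qnq` / `Row_F1qn` + `_excluded`, ancient rows, floor IT

Re-homed for the scenario census (typer seat ns-census-typer-1 g9; the cells F1qnq / F1qn, the ancient rows A-ni / A-qnq and the floor IT are MEMBERS OF RECORD «DECIDED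
IN KERNEL IN FILES» of row F1 since census v1.77 (critic backstop idea-crit-7 PASS 02:53Z; ref ns-census-ref g10 PRE-CHECK ✓ §15.15 item 39; lead-presearch label);
this port makes them TREE-decided): VERBATIM PORT of the NEW declarations of ns-idea-3 LINE 21 «quenched-top»,
`pub/ideators/ns-idea-3/lines/quenched-top/line-quenched-top.lean` sha16 1fb0c3b1193b8625 (1967 l., lean check rc 0, 0 sorry; its §2–§4 and the frame of §1 are shared
VERBATIM with LINES 18/20/22/23 and taken BY NAME from the landed `ScenarioCensusRowF1IntQuench*` / `…Inviscid*` / `…Frozen*` / `…IntStretch*` ports — 101 declarations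
not re-declared), split for the 400-line rule into `ScenarioCensusRowF1Quenched` (§1) → `…QuenchedTransfer` (§5–§6) → `…QuenchedTop` (§7 + census KEYS).  Lean text
VERBATIM in namespace `…Theorems.ScenarioCensus.QuenchedTop` (the line's `…Cruxes.ScenarioCensusRowF1.QuenchedTopLine` re-homed) with `open …IntegratedQuench`; port edits:
`@[conjecture]` on the residual `QuenchSlack` (≡ `ScenarioCensus.Row_F1`, OPEN), one-line docstrings added where missing (gate lint); `vort_eq` is the frozen-top port's
`freeze_eq` and `norm_laplacian_curl_le` (used only inside the shared kill) is not re-declared.  Statements untouched.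

No census VALUE is moved here (row F1 stays OPEN-WITH-LINE; the members become TREE-decided by name); NS regularity is NOT proved; `Row_F1` is untouched (zero
movement, `quenchSlack_iff_rowF1`); no summit statement is proved by this file. Lemmas that restate already-landed tree declarations are taken BY NAME (gate lint `dedup.landed`): `vort_eq` = `FrozenTop.freeze_eq`, `jointCond_everywhere₆` = `FrozenTop.jointCond_everywhere₄`, `nonIntensifying_ancient_trivial` = `eq_zero_of_nonIntensifying`.
-/

-- the summit and its single problem share the name `NavierStokesRegularity` (D-0017 nested layout)
set_option linter.dupNamespace false

noncomputable section

open MeasureTheory Set Function Filter TopologicalSpace Metric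
open scoped Topology NNReal ENNReal InnerProductSpace RealInnerProductSpace Laplacian

namespace Summit.NavierStokesRegularity.NavierStokesRegularity.Theorems.ScenarioCensus.QuenchedTop

open Literature.Analysis Literature.Analysis.FluidPDE
open Summit.NavierStokesRegularity.NavierStokesRegularity.Theorems
open Summit.NavierStokesRegularity.NavierStokesRegularity.Theorems.ScenarioCensus.IntegratedQuench

/-! ## §7 Rows, Liouville rows, floor, residual; the rows are EXCLUDED; displays; residual ≡ `Row_F1` -/

/-- **Criterion row F1qnq** (`M`-quantitative form: Type I(`M`) + ε(M)-QUENCHED TOP ⇒ extension): for every `M`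
ONE `ε > 0` such that the frame of `Row_F1` + `IsTypeIBlowupWith M ν u T` + a subcritical level on whose top
`(T − t)³ ⟪ω, ∂ₜω + (u·∇)ω⟫ ≤ ε` (half the material rate of `|ω|²`, one-sided) ⇒ `HasSmoothExtensionPast`.
No pressure and no viscosity in the criterion number.  PROVED (`rowF1qnq_holds`). -/
def Row_F1qnq : Prop :=
  ∀ M : ℝ, ∃ ε : ℝ, 0 < ε ∧ ∀ (ν T : ℝ), 0 < ν → 0 < T →
    ∀ (u : ℝ → E3 → E3) (p : ℝ → E3 → ℝ),
    IsClassicalNSSolutionOn (Ico 0 T) ν 0 u p → IsLerayHopfOn T ν 0 (u 0) u →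
    HasRapidSpatialDecay (u 0) → IsTypeIBlowupWith M ν u T →
    (∃ Λ : ℝ → ℝ, IsSubcriticalLevel T Λ ∧ HasQuenchDefectAt T Λ ε u) →
    HasSmoothExtensionPast ν 0 u T

/-- **Criterion row F1qn** (`o`-form, the exact frame of `Row_F1` plus ONE hypothesis: an `o`-QUENCHED TOP — some
subcritical level on whose top `(T − t)³ max(0, ½ Dₜ|ω|²) → 0`, i.e. the quench defect holds for EVERY `ε > 0`).
PROVED (`rowF1qn_holds`). -/
def Row_F1qn : Prop :=
  ∀ (ν T : ℝ), 0 < ν → 0 < T → ∀ (u : ℝ → E3 → E3) (p : ℝ → E3 → ℝ),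
    IsClassicalNSSolutionOn (Ico 0 T) ν 0 u p → IsLerayHopfOn T ν 0 (u 0) u →
    HasRapidSpatialDecay (u 0) → IsTypeIBlowup u T →
    (∃ Λ : ℝ → ℝ, IsSubcriticalLevel T Λ ∧ ∀ ε : ℝ, 0 < ε → HasQuenchDefectAt T Λ ε u) →
    HasSmoothExtensionPast ν 0 u T

/-- **Ancient row (exact, NON-INTENSIFYING vorticity)**: a `𝒦_C` field with `⟪ω, Δω + (ω·∇)W⟫ ≤ 0` on the open
past (`ω = curl W`; on the classical windows this is `½ (∂ₛ + W·∇)|ω|² ≤ 0`: the vorticity magnitude never grows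
along particle paths) is trivial.  PROVED (`liouville_nonIntensifying_holds`) — the line's new Liouville theorem. -/
def Liouville_nonIntensifying : Prop :=
  ∀ (C : ℝ) (W : ℝ → E3 → E3), IsTypeIAncientMild C W →
    (∀ s < (0 : ℝ), ∀ y : E3, ⟪curl (W s) y, (Δ (curl (W s))) y + convect (curl (W s)) (W s) y⟫ ≤ 0) →
    ∀ s < (0 : ℝ), ∀ y : E3, W s y = 0

/-- **Ancient row (ε-Liouville, almost-non-intensifying vorticity)**: ∀ M ∃ ε(M) > 0:
`(−s)³ ⟪ω, Δω + (ω·∇)W⟫ ≤ ε` on the open past ⇒ `W ≡ 0`.  PROVED (`liouville_qnq_holds`). -/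
def Liouville_qnq : Prop :=
  ∀ M : ℝ, ∃ ε : ℝ, 0 < ε ∧ ∀ W : ℝ → E3 → E3, IsTypeIAncientMild M W →
    (∀ s < (0 : ℝ), ∀ y : E3, (-s) ^ 3 *
      ⟪curl (W s) y, (Δ (curl (W s))) y + convect (curl (W s)) (W s) y⟫ ≤ ε) →
    ∀ s < (0 : ℝ), ∀ y : E3, W s y = 0

/-- **INTENSIFYING TOP** (structural floor, maximal frame): for every `M` one `ε(M) > 0` such that a maximal
Type-I(`M`) Clay blow-up has, on the top of EVERY subcritical level, no ε-quenched top: the vorticity magnitude of the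
fast fluid keeps INTENSIFYING ALONG PARTICLE PATHS at the Type-I rate, `½ Dₜ|ω|² > ε (T − t)⁻³`, infinitely often as
`t ↑ T`.  PROVED (`intensifyingTop_holds`). -/
def IntensifyingTop : Prop :=
  ∀ M : ℝ, ∃ ε : ℝ, 0 < ε ∧ ∀ (ν T : ℝ), 0 < ν → 0 < T →
    ∀ (u : ℝ → E3 → E3) (p : ℝ → E3 → ℝ),
    IsMaximalSmoothSolution ν 0 u p T → IsLerayHopfOn T ν 0 (u 0) u →
    HasRapidSpatialDecay (u 0) → IsTypeIBlowupWith M ν u T →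
    ∀ Λ : ℝ → ℝ, IsSubcriticalLevel T Λ → ¬ HasQuenchDefectAt T Λ ε u

/-- **Residual** (maximal frame): for every `M` and every `ε > 0`, every maximal Type-I(`M`) Clay blow-up has an
ε-quenched top at some subcritical level.  DECLARED ≡ row F1 (`quenchSlack_iff_rowF1`); no movement on `Row_F1`
is claimed. -/
@[conjecture] def QuenchSlack : Prop :=
  ∀ (M ε : ℝ), 0 < ε → ∀ (ν T : ℝ), 0 < ν → 0 < T →
    ∀ (u : ℝ → E3 → E3) (p : ℝ → E3 → ℝ),
    IsMaximalSmoothSolution ν 0 u p T → IsLerayHopfOn T ν 0 (u 0) u →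
    HasRapidSpatialDecay (u 0) → IsTypeIBlowupWith M ν u T →
    ∃ Λ : ℝ → ℝ, IsSubcriticalLevel T Λ ∧ HasQuenchDefectAt T Λ ε u

/-- **The split**: criterion + residual ⇒ row F1 (by cases on extendability; `M = C/√ν`). -/
theorem rowF1_of (hD : Row_F1qnq) (hR : QuenchSlack) : ScenarioCensus.Row_F1 := by
  unfold ScenarioCensus.Row_F1
  intro ν T hν hT u p hsol hLH hdec hTI
  obtain ⟨M, hM⟩ := exists_isTypeIBlowupWith hν hTI
  obtain ⟨ε, hε, hrow⟩ := hD M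
  by_contra hext
  exact hext (hrow ν T hν hT u p hsol hLH hdec hM (hR M ε hε ν T hν hT u p ⟨hsol, hext⟩ hLH hdec hM))

/-- The residual is a consequence of the row (vacuously: under `Row_F1` no maximal solution is Type I). -/
theorem quenchSlack_of_rowF1 (h : ScenarioCensus.Row_F1) : QuenchSlack :=
  fun _ _ _ ν T hν hT u p hmax hLH hdec hTI =>
    (hmax.2 (h ν T hν hT u p hmax.1 hLH hdec hTI.isTypeIBlowup)).elim

/-- The `o`-row follows from the `M`-quantitative row. -/
theorem rowF1qn_of_rowF1qnq (h : Row_F1qnq) : Row_F1qn := by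
  intro ν T hν hT u p hsol hLH hdec hTI ⟨Λ, hΛ, hall⟩
  obtain ⟨M, hM⟩ := exists_isTypeIBlowupWith hν hTI
  obtain ⟨ε, hε, hrow⟩ := h M
  exact hrow ν T hν hT u p hsol hLH hdec hM ⟨Λ, hΛ, hall ε hε⟩

/-- The Liouville rows hold (in kernel). -/
theorem liouville_nonIntensifying_holds : Liouville_nonIntensifying :=
  fun _ _ hW h => eq_zero_of_nonIntensifying hW h

/-- **Ancient row A-qnq holds.** -/
theorem liouville_qnq_holds : Liouville_qnq := exists_eps_liouville_quench

/-- **Criterion row F1qnq is EXCLUDED** (in kernel): Type I(`M`) + ε(M)-quenched top ⇒ extension. -/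
theorem rowF1qnq_holds : Row_F1qnq := by
  intro M
  obtain ⟨ε, hε, hLiou⟩ := exists_eps_liouville_quench M
  refine ⟨ε, hε, fun ν T hν hT u p hsol hLH hdec hTI htop => ?_⟩
  obtain ⟨Λ, hΛ, hdef⟩ := htop
  have hH : HasJointDefect₆At T Λ ν ε (fun v L H K => max 0 (intensOf v L H K)) u :=
    (hasStretchDefectAt_iff_joint hν hT hε.le hsol).1 ((hasQuenchDefectAt_iff hT hsol).1 hdef)
  apply hasSmoothExtensionPast_of_forall_exists_parabolicCylinder hν hT hsol hLH hdec
  intro x₀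
  by_contra hno
  obtain ⟨α, β, R, c, W, hα, hβ, hR, hαR, hαν, hcpos, hclim, hW, hpt, hgrad, hhess, hlap, t, ht, y, hne⟩ :=
    FrozenTop.exists_singularZoom_package₃ hν hT hsol hLH hdec hTI x₀ (InviscidTop.sing_of_not_bounded hno)
  have hall := joint_transfer_everywhere₆ hW hν hα hβ hαR hαν hcpos hclim hpt hgrad hhess hlap
    (Rd := fun v L H K => max 0 (intensOf v L H K)) (continuous_const.max continuous_intensOf)
    (fun a ha v L H K => by
      show max 0 (intensOf (a • v) (a ^ 2 • L) (a ^ 3 • H) (a ^ 4 • K)) = a ^ 6 * max 0 (intensOf v L H K)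
      rw [intensOf_smul, mul_max_of_nonneg _ _ (pow_pos ha 6).le, mul_zero])
    (by show max 0 (intensOf 0 0 0 0) = 0; rw [intensOf_zero, max_self]) hε.le hΛ hH
  refine hne (hLiou W hW (fun s hs y' => ?_) t ht y)
  have h3 : ContDiff ℝ 3 (W s) := (hW.contDiff_slice hs).of_le (by norm_cast)
  rw [intens_eq h3, ← mul_max_le_iff (pow_pos (neg_pos.2 hs) 3) hε.le]
  exact hall s hs y'

/-- The `o`-row holds (in kernel). -/
theorem rowF1qn_holds : Row_F1qn := rowF1qn_of_rowF1qnq rowF1qnq_holds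

/-- **Display (exact, ε-free, Lagrangian)**: Type I + a subcritical level on whose top the vorticity MAGNITUDE is
eventually NON-INCREASING ALONG PARTICLE PATHS (`⟪ω, ∂ₜω + (u·∇)ω⟫ ≤ 0` at the fast points) ⇒ extension. -/
theorem rowF1_nonIntensifyingTop : ∀ (ν T : ℝ), 0 < ν → 0 < T → ∀ (u : ℝ → E3 → E3) (p : ℝ → E3 → ℝ),
    IsClassicalNSSolutionOn (Ico 0 T) ν 0 u p → IsLerayHopfOn T ν 0 (u 0) u →
    HasRapidSpatialDecay (u 0) → IsTypeIBlowup u T →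
    (∃ Λ : ℝ → ℝ, IsSubcriticalLevel T Λ ∧ ∀ᶠ t in 𝓝[<] T, ∀ x : E3, Λ t < ‖u t x‖ →
      ⟪curl (u t) x, timeDerivWithin (Ico 0 T) (vorticity u) t x + convect (u t) (curl (u t)) x⟫ ≤ 0) →
    HasSmoothExtensionPast ν 0 u T := by
  intro ν T hν hT u p hsol hLH hdec hTI ⟨Λ, hΛ, hev⟩
  refine rowF1qn_holds ν T hν hT u p hsol hLH hdec hTI ⟨Λ, hΛ, fun ε hε => ?_⟩
  filter_upwards [hev, self_mem_nhdsWithin] with t ht htT x hx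
  have htT' : t < T := htT
  exact (mul_nonpos_of_nonneg_of_nonpos (pow_pos (sub_pos.2 htT') 3).le (ht x hx)).trans hε.le

/-- **The floor INTENSIFYING TOP holds.** -/
theorem intensifyingTop_holds : IntensifyingTop := by
  intro M
  obtain ⟨ε, hε, h⟩ := rowF1qnq_holds M
  exact ⟨ε, hε, fun ν T hν hT u p hmax hLH hdec hTI Λ hΛ hfr =>
    hmax.2 (h ν T hν hT u p hmax.1 hLH hdec hTI ⟨Λ, hΛ, hfr⟩)⟩

/-- **INTENSIFYING TOP, unfolded** (display, constant levels): ∀ M ∃ ε(M) > 0: in the maximal Type-I(`M`) Clay frame,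
for EVERY speed `Λ` and every `t₁ < T` some `t ∈ (t₁, T)` has a `Λ`-fast point with
`(T − t)³ ⟪ω, ∂ₜω + (u·∇)ω⟫(t, x) > ε` — the vorticity magnitude of the fast fluid of a Type-I blow-up keeps being
STRETCHED ALONG PARTICLE PATHS at the full Type-I rate. -/
theorem intensifyingTop_unfolded : ∀ M : ℝ, ∃ ε : ℝ, 0 < ε ∧ ∀ (ν T : ℝ), 0 < ν → 0 < T →
    ∀ (u : ℝ → E3 → E3) (p : ℝ → E3 → ℝ),
    IsMaximalSmoothSolution ν 0 u p T → IsLerayHopfOn T ν 0 (u 0) u →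
    HasRapidSpatialDecay (u 0) → IsTypeIBlowupWith M ν u T →
    ∀ Λ : ℝ, ∀ t₁ : ℝ, t₁ < T →
      ∃ t ∈ Ioo t₁ T, ∃ x : E3, Λ < ‖u t x‖ ∧
        ε < (T - t) ^ 3 *
          ⟪curl (u t) x, timeDerivWithin (Ico 0 T) (vorticity u) t x + convect (u t) (curl (u t)) x⟫ := by
  intro M
  obtain ⟨ε, hε, hfl⟩ := intensifyingTop_holds M
  refine ⟨ε, hε, fun ν T hν hT u p hmax hLH hdec hTI Λ t₁ ht₁ => ?_⟩
  by_contra hno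
  push Not at hno
  refine hfl ν T hν hT u p hmax hLH hdec hTI (fun _ => Λ) (isSubcriticalLevel_const T Λ) ?_
  exact eventually_of_mem (Ioo_mem_nhdsLT ht₁) fun t ht x hx => hno t ht x hx

/-- **INTENSIFYING TOP, kinematic display**: the same with the number written through the vorticity equation,
`(T − t)³ ⟪ω, ν Δω + (ω·∇)u⟫ > ε` at a fast point: vortex stretching beats diffusion at the Type-I rate. -/
theorem intensifyingTop_unfolded_stretch : ∀ M : ℝ, ∃ ε : ℝ, 0 < ε ∧ ∀ (ν T : ℝ), 0 < ν → 0 < T →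
    ∀ (u : ℝ → E3 → E3) (p : ℝ → E3 → ℝ),
    IsMaximalSmoothSolution ν 0 u p T → IsLerayHopfOn T ν 0 (u 0) u →
    HasRapidSpatialDecay (u 0) → IsTypeIBlowupWith M ν u T →
    ∀ Λ : ℝ, ∀ t₁ : ℝ, t₁ < T →
      ∃ t ∈ Ioo t₁ T, ∃ x : E3, Λ < ‖u t x‖ ∧
        ε < (T - t) ^ 3 * ⟪curl (u t) x, ν • (Δ (curl (u t))) x + convect (curl (u t)) (u t) x⟫ := by
  intro M
  obtain ⟨ε, hε, hfl⟩ := intensifyingTop_unfolded M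
  refine ⟨ε, hε, fun ν T hν hT u p hmax hLH hdec hTI Λ t₁ ht₁ => ?_⟩
  obtain ⟨t, ht, x, hx, hlt⟩ := hfl ν T hν hT u p hmax hLH hdec hTI Λ (max t₁ 0) (max_lt ht₁ hT)
  refine ⟨t, ⟨(le_max_left _ _).trans_lt ht.1, ht.2⟩, x, hx, ?_⟩
  rw [← quench_eq hT hmax.1 ⟨((le_max_right _ _).trans_lt ht.1).le, ht.2⟩ x]
  exact hlt

-- `nonIntensifying_ancient_trivial`: the line restates the tree's `eq_zero_of_nonIntensifying`; taken BY NAME (gate lint dedup.landed).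

/-- The residual is EXACTLY row F1 (declared; no movement on `Row_F1` is claimed). -/
theorem quenchSlack_iff_rowF1 : QuenchSlack ↔ ScenarioCensus.Row_F1 :=
  ⟨rowF1_of rowF1qnq_holds, quenchSlack_of_rowF1⟩

/-- Deciding direction used by the split. -/
theorem rowF1_of_quenchSlack : QuenchSlack → ScenarioCensus.Row_F1 :=
  rowF1_of rowF1qnq_holds

end Summit.NavierStokesRegularity.NavierStokesRegularity.Theorems.ScenarioCensus.QuenchedTop

namespace Summit.NavierStokesRegularity.NavierStokesRegularity.Theorems.ScenarioCensus

/-! ## Census KEYS (ns `…Theorems.ScenarioCensus`): the QUENCHED-TOP member of row F1 (LINE 21) — TREE-decided F1qnq / F1qn, ancient rows A-ni / A-qnq, floor IT -/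

/-- **Cell F1qnq** (`M`-quantitative: Type I(`M`) + ε(M)-QUENCHED TOP ⇒ smooth extension past `T`): `:= QuenchedTop.Row_F1qnq`. DECIDED. -/
def Row_F1qnq : Prop := QuenchedTop.Row_F1qnq
/-- F1qnq is EXCLUDED (decided in the tree): `QuenchedTop.rowF1qnq_holds`. -/
theorem row_F1qnq_excluded : Row_F1qnq := QuenchedTop.rowF1qnq_holds

/-- **Cell F1qn** (`o`-form: row F1 frame VERBATIM + an `o`-QUENCHED TOP ⇒ smooth extension past `T`): `:= QuenchedTop.Row_F1qn`. DECIDED. -/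
def Row_F1qn : Prop := QuenchedTop.Row_F1qn
/-- F1qn is EXCLUDED (decided in the tree): `QuenchedTop.rowF1qn_holds`. -/
theorem row_F1qn_excluded : Row_F1qn := QuenchedTop.rowF1qn_holds

/-- **Ancient row A-ni** (exact, NON-INTENSIFYING vorticity ⇒ trivial): `QuenchedTop.liouville_nonIntensifying_holds`. -/
theorem row_F1_liouvilleNonIntensifying : QuenchedTop.Liouville_nonIntensifying := QuenchedTop.liouville_nonIntensifying_holds
/-- **Ancient row A-qnq** (ε-Liouville, almost-non-intensifying vorticity): `QuenchedTop.liouville_qnq_holds`. -/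
theorem row_F1_liouvilleQnq : QuenchedTop.Liouville_qnq := QuenchedTop.liouville_qnq_holds
/-- **Floor IT — INTENSIFYING TOP**: `QuenchedTop.intensifyingTop_holds`. -/
theorem row_F1_intensifyingTop : QuenchedTop.IntensifyingTop := QuenchedTop.intensifyingTop_holds
/-- Lattice edge at key level: F1qnq ⇒ F1qn (`QuenchedTop.rowF1qn_of_rowF1qnq`). -/
theorem rowF1qn_of_rowF1qnq : Row_F1qnq → Row_F1qn := QuenchedTop.rowF1qn_of_rowF1qnq

end Summit.NavierStokesRegularity.NavierStokesRegularity.Theorems.ScenarioCensus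

end
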